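import Literature.Algebra.Homology.KInjectiveAdjunctionNaturality
import HarnessLib

/-!
# The derived adjunction on the K-injective model, III: action on representatives, naturality in the
# resolving variable, and independence of the chosen resolution

Topic `Algebra/Homology`; namespace `Literature.Algebra.Homology`. Pure homological algebra; everything proved,
no named fact. Sequel to `KInjectiveAdjunction.lean` and `KInjectiveAdjunctionNaturality.lean` (`Ψ =
shiftedHomLinearEquivOfAdjunction`, `Φ = shiftedHomLinearEquivOfAdjunctionOfQuasiIso`, `x♭ = ShiftedHom.transpose`).

* `ShiftedHom.transpose_mk₀_counit_comp` — `(ε_Y · w)♭ = w.map H`; `ShiftedHom.transpose_comp_mk₀` —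
  `(x · [u])♭ = x♭ · [H u]` (second-variable naturality of the transpose for morphisms `u`).
* **`shiftedHomLinearEquivOfAdjunction_mk₀_counit_comp_map`** — «`Rg_*` acts on representatives»: for a chain-level
  `w̃ : K ⟶ J⟦k⟧` (`J` bounded-below injective), `Ψ ([Q ε_K] · w̃.map Q) = (w̃.map R).map Q`.
* **`shiftedHomLinearEquivOfAdjunction_postcomp`** — `Ψ_{J'} (z ≫ (Q u)⟦a⟧') = Ψ_J z ≫ (Q (R u))⟦a⟧'` for a chain map
  `u : J ⟶ J'` of bounded-below injective complexes.
* `exists_quotient_map_comp_eq` — K-injective lifting: for a quasi-isomorphism `ι : E ⟶ I` and any `ι' : E ⟶ I'` with `I'`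
  bounded-below injective there is `u : I ⟶ I'` with `[ι ≫ u] = [ι']` in the homotopy category (Spaltenstein 1.5).
* **`shiftedHomLinearEquivOfAdjunctionOfQuasiIso_eq_of_quotient_map_comp_eq`** — INDEPENDENCE OF THE RESOLUTION: `Φ` computed
  with `ι : E ⟶ I` equals `Φ` computed with `ι' : E ⟶ I'` whenever `[ι ≫ u] = [ι']` for some `u` (so for ANY two injective
  resolutions with `R`-quasi-isomorphic structure maps, by the previous item).
* `shiftedHomLinearEquivOfAdjunctionOfQuasiIso_mk₀_counit_comp` — `Φ ([Q ε_K] · y) = (w̃.map R).map Q ≫ (Q(R ι))⁻¹⟦k⟧'` when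
  `y ≫ (Q ι)⟦k⟧' = w̃.map Q` («`g_{**} y` is `g_*` of a representative of `y` into the resolution»).

Written for the node `IsogenyDerivedAdjointPair` of Road №4 (stmt-HodgeConjecture-26512): these are the facts the (At)∕(Tr)
compatibilities and law (δ) consume about `g_{**} := adj ([Q ε•] · –)` of `isogenyDerivedAdjointPairOfRouteK`.

## References
* J. Lipman, *Notes on derived functors and Grothendieck duality*, LNM 1960 (2009), Prop. 3.2.3, Cor. 3.2.4. [Lipman2009]
* N. Spaltenstein, *Resolutions of unbounded complexes*, Compositio Math. 65 (1988), Prop. 1.5. [Spaltenstein1988]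
* C. A. Weibel, *An introduction to homological algebra* (1994), §10.4. [Weibel1994]
-/

noncomputable section

-- compositions through `(F ⋙ G).obj X = G.obj (F.obj X)` (as in Mathlib's `Shift/Adjunction.lean`)
set_option backward.isDefEq.respectTransparency false

open CategoryTheory CategoryTheory.Limits CategoryTheory.Category

namespace Literature.Algebra.Homology

universe w w' v v' u u'

/-! ### Two more transpose identities -/

section Transpose

variable {C : Type u} [Category.{v} C] {D : Type u'} [Category.{v'} D] {A : Type*} [AddMonoid A]
  [HasShift C A] [HasShift D A] {G : C ⥤ D} {H : D ⥤ C} (adj : G ⊣ H) [H.CommShift A]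

/-- **`(ε_Y · w)♭ = w.map H`**: the transpose of a shifted Hom out of `G(H Y)` that factors through the counit is `H`
applied to it. [cite: Weibel1994, §10.4] -/
theorem ShiftedHom.transpose_mk₀_counit_comp {Y Y' : D} {b : A} (w : ShiftedHom Y Y' b) :
    ShiftedHom.transpose adj ((ShiftedHom.mk₀ (X := G.obj (H.obj Y)) (Y := Y) (0 : A) rfl
      (adj.counit.app Y)).comp w (add_zero b)) = w.map H := by
  rw [ShiftedHom.transpose_eq, ShiftedHom.map_comp, ShiftedHom.map_mk₀, ShiftedHom.mk₀_comp]
  simp only [Functor.id_obj, CategoryTheory.Adjunction.right_triangle_components_assoc]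

/-- **Second-variable naturality of the transpose for morphisms**: `(x · [u])♭ = x♭ · [H u]`. [cite: Weibel1994, §10.4] -/
theorem ShiftedHom.transpose_comp_mk₀ {X : C} {Y Y' : D} {a : A} (x : ShiftedHom (G.obj X) Y a) (u : Y ⟶ Y') :
    ShiftedHom.transpose adj (x.comp (ShiftedHom.mk₀ (0 : A) rfl u) (zero_add a)) =
      (ShiftedHom.transpose adj x).comp (ShiftedHom.mk₀ (0 : A) rfl (H.map u)) (zero_add a) := by
  rw [ShiftedHom.transpose_comp, ShiftedHom.transpose_mk₀_counit_comp, ShiftedHom.map_mk₀]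

end Transpose

/-! ### `Ψ` on representatives and in the resolving variable -/

section KInjective

variable {𝕜 : Type*} [Ring 𝕜] {C : Type u} [Category.{v} C] [Abelian C] [Linear 𝕜 C]
  {D : Type u'} [Category.{v'} D] [Abelian D] [Linear 𝕜 D]
  [HasDerivedCategory.{w} C] [HasDerivedCategory.{w'} D]
  {L : C ⥤ D} {R : D ⥤ C} (adj : L ⊣ R) [L.Additive] [R.Additive] [R.Linear 𝕜] [L.PreservesMonomorphisms]

/-- **`Rg_*` acts on representatives**: for a chain-level shifted Hom `w̃ : K ⟶ J⟦k⟧` into a bounded-below complex of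
injectives, `Ψ ([Q ε_K] · w̃.map Q) = (w̃.map R).map Q`. [cite: Lipman2009, Prop. 3.2.3] -/
theorem shiftedHomLinearEquivOfAdjunction_mk₀_counit_comp_map (K J : CochainComplex D ℤ) (a : ℤ) [J.IsStrictlyGE a]
    [∀ n, Injective (J.X n)] (k : ℤ) (w : ShiftedHom K J k) :
    shiftedHomLinearEquivOfAdjunction (𝕜 := 𝕜) adj ((R.mapHomologicalComplex (ComplexShape.up ℤ)).obj K) J a k
        ((ShiftedHom.mk₀ (0 : ℤ) rfl (DerivedCategory.Q.map
          (X := (L.mapHomologicalComplex (ComplexShape.up ℤ)).obj ((R.mapHomologicalComplex (ComplexShape.up ℤ)).obj K))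
          (Y := K) ((mapHomologicalComplexAdj adj (ComplexShape.up ℤ)).counit.app K))).comp
          (w.map DerivedCategory.Q) (add_zero k)) =
      (w.map (R.mapHomologicalComplex (ComplexShape.up ℤ))).map DerivedCategory.Q := by
  rw [← ShiftedHom.map_mk₀ (0 : ℤ) rfl _ DerivedCategory.Q, ← ShiftedHom.map_comp,
    shiftedHomLinearEquivOfAdjunction_map, ShiftedHom.transpose_mk₀_counit_comp]

/-- Plain form of the previous lemma: `Ψ (Q ε_K ≫ w̃.map Q) = (w̃.map R).map Q`. [cite: Lipman2009, Prop. 3.2.3] -/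
theorem shiftedHomLinearEquivOfAdjunction_counit_comp_map (K J : CochainComplex D ℤ) (a : ℤ) [J.IsStrictlyGE a]
    [∀ n, Injective (J.X n)] (k : ℤ) (w : ShiftedHom K J k) :
    shiftedHomLinearEquivOfAdjunction (𝕜 := 𝕜) adj ((R.mapHomologicalComplex (ComplexShape.up ℤ)).obj K) J a k
        (DerivedCategory.Q.map
          (X := (L.mapHomologicalComplex (ComplexShape.up ℤ)).obj ((R.mapHomologicalComplex (ComplexShape.up ℤ)).obj K))
          (Y := K) ((mapHomologicalComplexAdj adj (ComplexShape.up ℤ)).counit.app K) ≫ w.map DerivedCategory.Q :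
          ShiftedHom _ (DerivedCategory.Q.obj J) k) =
      (w.map (R.mapHomologicalComplex (ComplexShape.up ℤ))).map DerivedCategory.Q := by
  rw [← shiftedHomLinearEquivOfAdjunction_mk₀_counit_comp_map (𝕜 := 𝕜) adj K J a k w, ShiftedHom.mk₀_comp]

/-- **Naturality of `Ψ` in the resolving variable for chain maps**: `Ψ_{J'} (z ≫ (Q u)⟦a⟧') = Ψ_J z ≫ (Q (R u))⟦a⟧'`
for `u : J ⟶ J'` between bounded-below complexes of injectives. [cite: Lipman2009, Prop. 3.2.3] -/
theorem shiftedHomLinearEquivOfAdjunction_postcomp (M : CochainComplex C ℤ) {J J' : CochainComplex D ℤ} (aJ aJ' : ℤ)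
    [J.IsStrictlyGE aJ] [∀ n, Injective (J.X n)] [J'.IsStrictlyGE aJ'] [∀ n, Injective (J'.X n)] (u : J ⟶ J')
    (k : ℤ) (z : ShiftedHom (DerivedCategory.Q.obj ((L.mapHomologicalComplex (ComplexShape.up ℤ)).obj M))
      (DerivedCategory.Q.obj J) k) :
    shiftedHomLinearEquivOfAdjunction (𝕜 := 𝕜) adj M J' aJ' k
        (z ≫ (DerivedCategory.Q.map u)⟦k⟧' : ShiftedHom _ (DerivedCategory.Q.obj J') k) =
      shiftedHomLinearEquivOfAdjunction (𝕜 := 𝕜) adj M J aJ k z ≫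
        (DerivedCategory.Q.map ((R.mapHomologicalComplex (ComplexShape.up ℤ)).map u))⟦k⟧' := by
  obtain ⟨z, rfl⟩ := exists_map_Q_eq _ J aJ k z
  rw [← ShiftedHom.comp_mk₀ _ (0 : ℤ) rfl, ← ShiftedHom.comp_mk₀ _ (0 : ℤ) rfl,
    ← ShiftedHom.map_mk₀ (0 : ℤ) rfl _ DerivedCategory.Q, ← ShiftedHom.map_comp,
    shiftedHomLinearEquivOfAdjunction_map, shiftedHomLinearEquivOfAdjunction_map, ShiftedHom.transpose_comp_mk₀,
    ShiftedHom.map_comp, ShiftedHom.map_mk₀]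

/-! ### K-injective lifting and independence of the resolution -/

/-- **K-injective lifting along a quasi-isomorphism** (Spaltenstein 1.5): for `ι : E ⟶ I` a quasi-isomorphism and
`ι' : E ⟶ I'` with `I'` a bounded-below complex of injectives there is a chain map `u : I ⟶ I'` with `[ι ≫ u] = [ι']` in the
homotopy category. [cite: Spaltenstein1988, Prop. 1.5] -/
theorem exists_quotient_map_comp_eq {E : Type u'} [Category.{v'} E] [Abelian E] [HasDerivedCategory.{w'} E]
    {X I I' : CochainComplex E ℤ} (ι : X ⟶ I) [QuasiIso ι] (ι' : X ⟶ I') (a : ℤ) [I'.IsStrictlyGE a]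
    [∀ n, Injective (I'.X n)] :
    ∃ u : I ⟶ I', (HomotopyCategory.quotient E _).map (ι ≫ u) = (HomotopyCategory.quotient E _).map ι' := by
  haveI : I'.IsKInjective := CochainComplex.isKInjective_of_injective I' a
  haveI : IsIso (DerivedCategory.Qh.map ((HomotopyCategory.quotient E _).map ι)) := by
    change IsIso ((HomotopyCategory.quotient E _ ⋙ DerivedCategory.Qh).map ι)
    rw [NatIso.isIso_map_iff (DerivedCategory.quotientCompQhIso E), DerivedCategory.isIso_Q_map_iff_quasiIso]
    infer_instance
  obtain ⟨φ, hφ⟩ := (CochainComplex.IsKInjective.Qh_map_bijective ((HomotopyCategory.quotient E _).obj I) I').2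
    (inv (DerivedCategory.Qh.map ((HomotopyCategory.quotient E _).map ι)) ≫
      DerivedCategory.Qh.map ((HomotopyCategory.quotient E _).map ι'))
  obtain ⟨u, rfl⟩ := (HomotopyCategory.quotient E _).map_surjective φ
  refine ⟨u, (CochainComplex.IsKInjective.Qh_map_bijective ((HomotopyCategory.quotient E _).obj X) I').1 ?_⟩
  rw [Functor.map_comp, Functor.map_comp, hφ, IsIso.hom_inv_id_assoc]

/-- `Q` of homotopic maps agree (through `quotient ⋙ Qh ≅ Q`). [cite: Spaltenstein1988, Prop. 1.5] -/
theorem Q_map_eq_of_quotient_map_eq {E : Type u'} [Category.{v'} E] [Abelian E] [HasDerivedCategory.{w'} E]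
    {X Y : CochainComplex E ℤ} {f f' : X ⟶ Y}
    (h : (HomotopyCategory.quotient E _).map f = (HomotopyCategory.quotient E _).map f') :
    DerivedCategory.Q.map f = DerivedCategory.Q.map f' := by
  have hf := DerivedCategory.quotientCompQhIso_hom_naturality (C := E) f
  have hf' := DerivedCategory.quotientCompQhIso_hom_naturality (C := E) f'
  rw [h, hf'] at hf
  exact ((cancel_epi _).1 hf).symm

/-- **Independence of the resolution**: if `ι : E ⟶ I` and `ι' : E ⟶ I'` are quasi-isomorphisms into bounded-below complexes of
injectives, `R ι` and `R ι'` are quasi-isomorphisms, and `u : I ⟶ I'` satisfies `[ι ≫ u] = [ι']` in the homotopy category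
(such `u` exists, `exists_quotient_map_comp_eq`), then `Φ` computed with `ι` equals `Φ` computed with `ι'`.
[cite: Lipman2009, Prop. 3.2.3 and Cor. 3.2.4] [cite: Spaltenstein1988, Prop. 1.5] -/
theorem shiftedHomLinearEquivOfAdjunctionOfQuasiIso_eq_of_quotient_map_comp_eq (M : CochainComplex C ℤ)
    {E I I' : CochainComplex D ℤ} (ι : E ⟶ I) [QuasiIso ι] (a : ℤ) [I.IsStrictlyGE a] [∀ n, Injective (I.X n)]
    (hR : QuasiIso ((R.mapHomologicalComplex (ComplexShape.up ℤ)).map ι))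
    (ι' : E ⟶ I') [QuasiIso ι'] (a' : ℤ) [I'.IsStrictlyGE a'] [∀ n, Injective (I'.X n)]
    (hR' : QuasiIso ((R.mapHomologicalComplex (ComplexShape.up ℤ)).map ι'))
    (u : I ⟶ I') (hu : (HomotopyCategory.quotient D _).map (ι ≫ u) = (HomotopyCategory.quotient D _).map ι')
    (k : ℤ) (x : ShiftedHom (DerivedCategory.Q.obj ((L.mapHomologicalComplex (ComplexShape.up ℤ)).obj M))
      (DerivedCategory.Q.obj E) k) :
    shiftedHomLinearEquivOfAdjunctionOfQuasiIso (𝕜 := 𝕜) adj M ι a hR k x =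
      shiftedHomLinearEquivOfAdjunctionOfQuasiIso (𝕜 := 𝕜) adj M ι' a' hR' k x := by
  haveI : IsIso (DerivedCategory.Q.map ((R.mapHomologicalComplex (ComplexShape.up ℤ)).map ι)) := by
    rw [DerivedCategory.isIso_Q_map_iff_quasiIso]; exact hR
  haveI : IsIso (DerivedCategory.Q.map ((R.mapHomologicalComplex (ComplexShape.up ℤ)).map ι')) := by
    rw [DerivedCategory.isIso_Q_map_iff_quasiIso]; exact hR'
  -- `Q ι' = Q ι ≫ Q u` and `Q(R ι') = Q(R ι) ≫ Q(R u)` (homotopic maps; `R` preserves homotopies)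
  have hQ : DerivedCategory.Q.map ι' = DerivedCategory.Q.map ι ≫ DerivedCategory.Q.map u := by
    rw [← DerivedCategory.Q.map_comp]; exact (Q_map_eq_of_quotient_map_eq hu).symm
  have hRu : (HomotopyCategory.quotient C _).map ((R.mapHomologicalComplex (ComplexShape.up ℤ)).map (ι ≫ u)) =
      (HomotopyCategory.quotient C _).map ((R.mapHomologicalComplex (ComplexShape.up ℤ)).map ι') := by
    rw [← Functor.mapHomotopyCategory_map, ← Functor.mapHomotopyCategory_map, hu]
  have hQR : DerivedCategory.Q.map ((R.mapHomologicalComplex (ComplexShape.up ℤ)).map ι') =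
      DerivedCategory.Q.map ((R.mapHomologicalComplex (ComplexShape.up ℤ)).map ι) ≫
        DerivedCategory.Q.map ((R.mapHomologicalComplex (ComplexShape.up ℤ)).map u) := by
    rw [← DerivedCategory.Q.map_comp, ← Functor.map_comp]; exact (Q_map_eq_of_quotient_map_eq hRu).symm
  haveI : IsIso (DerivedCategory.Q.map ((R.mapHomologicalComplex (ComplexShape.up ℤ)).map ι) ≫
      DerivedCategory.Q.map ((R.mapHomologicalComplex (ComplexShape.up ℤ)).map u)) := by
    rw [← hQR]; infer_instance
  haveI : IsIso (DerivedCategory.Q.map ((R.mapHomologicalComplex (ComplexShape.up ℤ)).map u)) :=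
    IsIso.of_isIso_comp_left (DerivedCategory.Q.map ((R.mapHomologicalComplex (ComplexShape.up ℤ)).map ι))
      (DerivedCategory.Q.map ((R.mapHomologicalComplex (ComplexShape.up ℤ)).map u))
  have hinv : inv (DerivedCategory.Q.map ((R.mapHomologicalComplex (ComplexShape.up ℤ)).map ι')) =
      inv (DerivedCategory.Q.map ((R.mapHomologicalComplex (ComplexShape.up ℤ)).map u)) ≫
        inv (DerivedCategory.Q.map ((R.mapHomologicalComplex (ComplexShape.up ℤ)).map ι)) := by
    apply IsIso.inv_eq_of_hom_inv_id
    rw [hQR, assoc, IsIso.hom_inv_id_assoc, IsIso.hom_inv_id]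
  rw [shiftedHomLinearEquivOfAdjunctionOfQuasiIso_eq, shiftedHomLinearEquivOfAdjunctionOfQuasiIso_eq, hinv, hQ,
    Functor.map_comp, Functor.map_comp, ← assoc x, shiftedHomLinearEquivOfAdjunction_postcomp (𝕜 := 𝕜) adj M a a' u,
    assoc, ← (shiftFunctor (DerivedCategory C) k).map_comp_assoc, IsIso.hom_inv_id, CategoryTheory.Functor.map_id,
    id_comp]

/-- **Independence of the resolution, packaged**: any two injective resolutions with `R`-quasi-isomorphic structure maps
compute the same `Φ`. [cite: Lipman2009, Prop. 3.2.3 and Cor. 3.2.4] [cite: Spaltenstein1988, Prop. 1.5] -/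
theorem shiftedHomLinearEquivOfAdjunctionOfQuasiIso_eq_of_resolutions (M : CochainComplex C ℤ)
    {E I I' : CochainComplex D ℤ} (ι : E ⟶ I) [QuasiIso ι] (a : ℤ) [I.IsStrictlyGE a] [∀ n, Injective (I.X n)]
    (hR : QuasiIso ((R.mapHomologicalComplex (ComplexShape.up ℤ)).map ι))
    (ι' : E ⟶ I') [QuasiIso ι'] (a' : ℤ) [I'.IsStrictlyGE a'] [∀ n, Injective (I'.X n)]
    (hR' : QuasiIso ((R.mapHomologicalComplex (ComplexShape.up ℤ)).map ι')) (k : ℤ) :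
    shiftedHomLinearEquivOfAdjunctionOfQuasiIso (𝕜 := 𝕜) adj M ι a hR k =
      shiftedHomLinearEquivOfAdjunctionOfQuasiIso (𝕜 := 𝕜) adj M ι' a' hR' k := by
  obtain ⟨u, hu⟩ := exists_quotient_map_comp_eq ι ι' a'
  exact LinearEquiv.ext fun x =>
    shiftedHomLinearEquivOfAdjunctionOfQuasiIso_eq_of_quotient_map_comp_eq adj M ι a hR ι' a' hR' u hu k x

/-- **`Φ ([Q ε_K] · y)` on a representative**: if `y ≫ (Q ι)⟦k⟧' = w̃.map Q` for a chain-level `w̃ : K ⟶ I⟦k⟧` into the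
resolution `ι : E ⟶ I`, then `Φ ([Q ε_K] · y) = (w̃.map R).map Q ≫ (Q (R ι))⁻¹⟦k⟧'` — i.e. «`g_{**} y` is `g_*` applied termwise
to a representative of `y`». [cite: Lipman2009, Prop. 3.2.3] -/
theorem shiftedHomLinearEquivOfAdjunctionOfQuasiIso_mk₀_counit_comp (K : CochainComplex D ℤ) {E I : CochainComplex D ℤ}
    (ι : E ⟶ I) [QuasiIso ι] (a : ℤ) [I.IsStrictlyGE a] [∀ n, Injective (I.X n)]
    (hR : QuasiIso ((R.mapHomologicalComplex (ComplexShape.up ℤ)).map ι)) (k : ℤ)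
    (y : ShiftedHom (DerivedCategory.Q.obj K) (DerivedCategory.Q.obj E) k) (w : ShiftedHom K I k)
    (hw : (y ≫ (DerivedCategory.Q.map ι)⟦k⟧' : ShiftedHom _ (DerivedCategory.Q.obj I) k) = w.map DerivedCategory.Q) :
    haveI : IsIso (DerivedCategory.Q.map ((R.mapHomologicalComplex (ComplexShape.up ℤ)).map ι)) := by
      rw [DerivedCategory.isIso_Q_map_iff_quasiIso]; exact hR
    shiftedHomLinearEquivOfAdjunctionOfQuasiIso (𝕜 := 𝕜) adj ((R.mapHomologicalComplex (ComplexShape.up ℤ)).obj K) ι a hR k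
        ((ShiftedHom.mk₀ (0 : ℤ) rfl (DerivedCategory.Q.map
          (X := (L.mapHomologicalComplex (ComplexShape.up ℤ)).obj ((R.mapHomologicalComplex (ComplexShape.up ℤ)).obj K))
          (Y := K) ((mapHomologicalComplexAdj adj (ComplexShape.up ℤ)).counit.app K))).comp y (add_zero k)) =
      (w.map (R.mapHomologicalComplex (ComplexShape.up ℤ))).map DerivedCategory.Q ≫
        (inv (DerivedCategory.Q.map ((R.mapHomologicalComplex (ComplexShape.up ℤ)).map ι)))⟦k⟧' := by
  rw [shiftedHomLinearEquivOfAdjunctionOfQuasiIso_eq, ShiftedHom.mk₀_comp, assoc, hw,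
    shiftedHomLinearEquivOfAdjunction_counit_comp_map]

end KInjective

end Literature.Algebra.Homology

end
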